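import Summits.Ventures.PercRepro.Night2NonFatOneHyp
import Summits.Ventures.PercRepro.Night2NonFatLevelAny

/-!
# night-2: the NON-FAT case of (FAIR) — the level-2 face sum by the INCIDENCE MASS of the outside points (gen 37)

At a target `T = Q ∪ Y` a member face `B′` has `|G ∖ cl B′| = |(T ∖ K) ∖ cl B′| + |(W ∖ Y) ∖ cl B′|`, so it misses at least
`1 + (N − |Y|) − i` points where `i = |(W ∖ Y) ∩ cl B′|` is the number of OUTSIDE points on its hyperplane.  For `N ≥ |Y| + 9`
the face weight is below the chord in `m` (`phiM_le_chord_m`: `phiM m ≤ (1/9)(N − |Y| − 1 − m)/(N − |Y| − 4)` for `3 ≤ m ≤ N − |Y| − 1`), hence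
`phiFace B′ · |(T ∖ K) ∖ cl B′| ≤ (|T ∖ K| − 4)/9 · i/(N − |Y| − 2)` and
**`faceSum_le_incidence_mass`**: `faceSum (Q ∪ Y) ≤ (|T ∖ K| − 4)/9 · (Σ_{B′ ∈ facesIn T} |(W ∖ Y) ∩ cl B′|) / (N − |Y| − 4)`.
The incidence mass `Σ_{B′} |(W ∖ Y) ∩ cl B′| = Σ_{y′′ ∉ Y} #{faces of T whose hyperplane contains y′′}` is the currency of the
generic regime: an outside point in general position with respect to `T ∖ K` costs nothing, a point on a line through two of its
points at most `C(|T ∖ K| − 2, 2)` faces, on a plane through three at most `|T ∖ K| − 3`, on a hyperplane through four exactly one.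
At level 2 (`|T ∖ K| = 7`, `N ≥ 11`): `faceSum ≤ (1/3) · mass/(N − 6)`.
Paper: proofs/NIGHT-2-g37.md §6.
-/

namespace PercRepro.Shadow

open PercRepro.ThmH PercRepro.PerFlat

variable {α : Type*} [DecidableEq α] {M : Matroid α} [M.Finite] {G : Finset α}

/-- **The chord bound in `m`**: for `3 ≤ m ≤ R − 1` and `R ≥ 9`, `phiM m ≤ (1/9) · (R − 1 − m)/(R − 4)`. -/
theorem phiM_le_chord_m {R m : ℕ} (hR : 9 ≤ R) (hm3 : 3 ≤ m) (hmR : m + 1 ≤ R) :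
    phiM m ≤ 1 / 9 * (((R - 1 - m : ℕ) : ℚ) / ((R : ℚ) - 4)) := by
  unfold phiM phiQ
  have hR' : (9 : ℚ) ≤ (R : ℚ) := by exact_mod_cast hR
  have hm3' : (3 : ℚ) ≤ (m : ℚ) := by exact_mod_cast hm3
  have hmR' : (m : ℚ) + 1 ≤ (R : ℚ) := by exact_mod_cast hmR
  have hcast : ((R - 1 - m : ℕ) : ℚ) = (R : ℚ) - 1 - (m : ℚ) := by
    rw [Nat.cast_sub (by omega), Nat.cast_sub (by omega), Nat.cast_one]
  rw [hcast]
  have hpos : (0 : ℚ) < (R : ℚ) - 4 := by linarith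
  have hu : (0 : ℚ) ≤ (R : ℚ) - 1 - (m : ℚ) := by linarith
  apply max_le
  · exact mul_nonneg (by norm_num) (div_nonneg hu hpos.le)
  · rw [sub_le_iff_le_add, div_le_iff₀ (by linarith)]
    rw [mul_div_assoc', div_add' _ _ _ hpos.ne', div_mul_eq_mul_div, le_div_iff₀ hpos]
    nlinarith [mul_nonneg hu (by linarith : (0 : ℚ) ≤ 11 * ((R : ℚ) - 4) - 10 * ((R : ℚ) - 1 - (m : ℚ)) - 50 + 60)]

/-- The points of `G` off the closure of a member face inside `T`: those of `T ∖ K` and those of `W ∖ Y` off it. -/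
theorem card_sdiff_clF_split (hG : G ∈ flatsQ M (5 + 1)) (hd : (gr M \ G).card = 2)
    {B : Finset α} (hB : B ∈ thinMembers M 5 G) {z : α} (hz : z ∈ G \ clF M B)
    {Y : Finset α} (hY : Y ⊆ G \ insert z B) {B' : Finset α} (hB' : B' ∈ thinMembers M 5 G) :
    (G \ clF M B').card = (((insert z B ∪ Y) \ coloops M G) \ clF M B').card +
      (((G \ insert z B) \ Y).filter (fun y => y ∉ clF M B')).card := by
  have hd' : (gr M \ G).card ≤ 5 := by omega
  have hKB' : coloops M G ⊆ B' := coloops_subset_of_mem_thinMembers hG hd' hB'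
  have hQG : insert z B ⊆ G := Finset.insert_subset (Finset.mem_sdiff.1 hz).1 (subset_G_of_mem_thinMembers hB)
  have hGg : G ⊆ gr M := (mem_flatsQ.1 hG).1
  rw [← Finset.card_union_of_disjoint]
  · congr 1
    ext e
    constructor
    · intro he
      rw [Finset.mem_sdiff] at he
      rw [Finset.mem_union, Finset.mem_sdiff, Finset.mem_sdiff, Finset.mem_filter, Finset.mem_sdiff, Finset.mem_sdiff]
      by_cases heT : e ∈ insert z B ∪ Y
      · left
        refine ⟨⟨heT, fun hK => he.2 ?_⟩, he.2⟩
        exact subset_clF_of_subset_gr ((subset_G_of_mem_thinMembers hB').trans hGg) (hKB' hK)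
      · right
        rw [Finset.mem_union, not_or] at heT
        exact ⟨⟨⟨he.1, heT.1⟩, heT.2⟩, he.2⟩
    · intro he
      rw [Finset.mem_union, Finset.mem_sdiff, Finset.mem_sdiff, Finset.mem_filter, Finset.mem_sdiff, Finset.mem_sdiff] at he
      rw [Finset.mem_sdiff]
      rcases he with ⟨⟨heT, -⟩, hecl⟩ | ⟨⟨⟨heG, -⟩, -⟩, hecl⟩
      · exact ⟨(Finset.union_subset hQG (hY.trans Finset.sdiff_subset)) heT, hecl⟩
      · exact ⟨heG, hecl⟩
  · rw [Finset.disjoint_left]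
    intro e he1 he2
    rw [Finset.mem_sdiff, Finset.mem_sdiff] at he1
    rw [Finset.mem_filter, Finset.mem_sdiff, Finset.mem_sdiff] at he2
    have := he1.1.1
    rw [Finset.mem_union] at this
    rcases this with h | h
    · exact he2.1.1.2 h
    · exact he2.1.2 h

open scoped Classical in
/-- **The face sum by the incidence mass of the outside points** (`N ≥ |Y| + 9`): every member face inside `T = Q ∪ Y`
misses `≥ 1 + (N − |Y|) − i` points, `i` the outside points on its hyperplane, and the chord in `m` bounds its weight by
`(|T ∖ K| − 4)/9 · i/(N − |Y| − 4)`. -/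
theorem faceSum_le_incidence_mass (hG : G ∈ flatsQ M (5 + 1)) (hd : (gr M \ G).card = 2) (hk : kColoops M G = 1)
    (hnf : fatClosures M 5 G 2 = ∅) {B : Finset α} (hB : B ∈ thinMembers M 5 G) (hnP : ¬ bigP M G B) {z : α}
    (hz : z ∈ G \ clF M B) {Y : Finset α} (hY : Y ⊆ G \ insert z B) (hN : Y.card + 9 ≤ (G \ insert z B).card) :
    faceSum M G (insert z B ∪ Y) ≤
      (((((insert z B ∪ Y) \ coloops M G).card - 4 : ℕ) : ℚ) / 9) *
        ((∑ B' ∈ facesIn M G (insert z B ∪ Y), ((((G \ insert z B) \ Y).filter (fun y => y ∈ clF M B')).card : ℚ)) /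
          ((((G \ insert z B).card - Y.card : ℕ) : ℚ) - 4)) := by
  have hd' : (gr M \ G).card ≤ 5 := by omega
  set R : ℕ := (G \ insert z B).card - Y.card with hRdef
  have hR9 : 9 ≤ R := by omega
  have hR' : (9 : ℚ) ≤ (R : ℚ) := by exact_mod_cast hR9
  have hRpos : (0 : ℚ) < (R : ℚ) - 4 := by linarith
  set c : ℕ := ((insert z B ∪ Y) \ coloops M G).card - 4 with hcdef
  have hYcard : ((G \ insert z B) \ Y).card = R := by
    rw [hRdef, Finset.card_sdiff_of_subset hY]
  rw [faceSum_eq_sum_facesIn, Finset.sum_div, Finset.mul_sum]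
  apply Finset.sum_le_sum
  intro B' hB'
  have hB'in := hB'
  unfold facesIn at hB'in
  rw [Finset.mem_filter] at hB'in
  obtain ⟨hB'thin, hnP', hB'T⟩ := hB'in
  have hKB' : coloops M G ⊆ B' := coloops_subset_of_mem_thinMembers hG hd' hB'thin
  have hm3 := three_le_card_sdiff_of_nonfat hnf hB'thin
  have hsplit := card_sdiff_clF_split hG hd hB hz hY hB'thin
  have hfilt := Finset.card_filter_add_card_filter_not (s := (G \ insert z B) \ Y) (fun y => y ∈ clF M B')
  rw [hYcard] at hfilt
  -- the weight factor: `|(T ∖ K) ∖ cl B′| ≤ |T ∖ K| − 4`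
  have hc : (((insert z B ∪ Y) \ coloops M G) \ clF M B').card ≤ c := by
    have h4 := card_sdiff_eq_four_of_not_bigP hG hd hk hB'thin hnP'
    have hsub : B' \ coloops M G ⊆ (insert z B ∪ Y) \ coloops M G := Finset.sdiff_subset_sdiff hB'T (le_refl _)
    have hsub2 : ((insert z B ∪ Y) \ coloops M G) \ clF M B' ⊆ ((insert z B ∪ Y) \ coloops M G) \ (B' \ coloops M G) := by
      intro e he
      rw [Finset.mem_sdiff] at he ⊢
      refine ⟨he.1, fun h => he.2 ?_⟩
      exact subset_clF_of_subset_gr ((subset_G_of_mem_thinMembers hB'thin).trans (mem_flatsQ.1 hG).1)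
        (Finset.mem_sdiff.1 h).1
    have := Finset.card_le_card hsub2
    rw [Finset.card_sdiff_of_subset hsub, h4] at this
    omega
  -- the closure misses `c′ + (R − i)` points with `c′ ≥ 1`
  set i : ℕ := (((G \ insert z B) \ Y).filter (fun y => y ∈ clF M B')).card with hidef
  have hc1 : 1 ≤ (((insert z B ∪ Y) \ coloops M G) \ clF M B').card := by
    -- the closure of `B′` has rank `5 < 6 = rk T`, so some point of `T ∖ K` is off it
    by_contra h0
    rw [not_le, Nat.lt_one_iff, Finset.card_eq_zero, Finset.sdiff_eq_empty_iff_subset] at h0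
    have hsub : insert z B ∪ Y ⊆ clF M B' := by
      intro e he
      by_cases heK : e ∈ coloops M G
      · exact subset_clF_of_subset_gr ((subset_G_of_mem_thinMembers hB'thin).trans (mem_flatsQ.1 hG).1) (hKB' heK)
      · exact h0 (Finset.mem_sdiff.2 ⟨he, heK⟩)
    have h6 : rkN M (insert z B ∪ Y) = 6 := by
      have hQ6 := rkN_insert_eq_card hG hd hk hB hnP hz
      have hQG : insert z B ⊆ G := Finset.insert_subset (Finset.mem_sdiff.1 hz).1 (subset_G_of_mem_thinMembers hB)
      have hTG : insert z B ∪ Y ⊆ G := Finset.union_subset hQG (hY.trans Finset.sdiff_subset)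
      have h1 := rkN_mono (M := M) (Finset.subset_union_left : insert z B ⊆ insert z B ∪ Y)
      have h2 := rkN_mono (M := M) hTG
      have hG6 : rkN M G = 6 := rkN_eq_of_mem_flatsQ hG
      have hQcard : (insert z B).card = 6 := by
        have h4 := card_sdiff_eq_four_of_not_bigP hG hd hk hB hnP
        have hKB := coloops_subset_of_mem_thinMembers hG hd' hB
        have hzB : z ∉ B := fun h => (Finset.mem_sdiff.1 hz).2
          (subset_clF_of_subset_gr ((subset_G_of_mem_thinMembers hB).trans (mem_flatsQ.1 hG).1) h)
        have h1' := Finset.card_sdiff_add_card_eq_card hKB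
        rw [← kColoops_eq_card_coloops, hk, h4] at h1'
        rw [Finset.card_insert_of_notMem hzB]
        omega
      omega
    have h5 := rkN_eq_five_of_mem_thinMembers hB'thin
    have := rkN_le_of_subset_clF' (M := M) hsub
    omega
  -- the chord: `phiFace B′ ≤ (1/9)(R − 1 − m)/(R − 4)` with `R − 1 − m ≤ i`
  by_cases hbig : (G \ clF M B').card + 1 ≤ R
  · have hphi := le_trans (phiFace_le_of_le hG hd hB'thin (le_refl _)) (phiM_le_chord_m hR9 hm3 hbig)
    have hRi : ((R - 1 - (G \ clF M B').card : ℕ) : ℚ) ≤ (i : ℚ) := by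
      have : R - 1 - (G \ clF M B').card ≤ i := by omega
      exact_mod_cast this
    have hc' : ((((insert z B ∪ Y) \ coloops M G) \ clF M B').card : ℚ) ≤ (c : ℚ) := by exact_mod_cast hc
    have hi0 : (0 : ℚ) ≤ (i : ℚ) := by positivity
    unfold hypWeight
    rw [← phiFace_eq_of_clF]
    calc phiFace M B' * ((((insert z B ∪ Y) \ coloops M G) \ clF M B').card : ℚ)
        ≤ (1 / 9 * (((R - 1 - (G \ clF M B').card : ℕ) : ℚ) / ((R : ℚ) - 4))) * (c : ℚ) :=
          mul_le_mul hphi hc' (by positivity) (by positivity)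
      _ ≤ (1 / 9 * ((i : ℚ) / ((R : ℚ) - 4))) * (c : ℚ) := by
          apply mul_le_mul_of_nonneg_right _ (by positivity)
          apply mul_le_mul_of_nonneg_left _ (by norm_num)
          exact div_le_div_of_nonneg_right hRi hRpos.le
      _ = (c : ℚ) / 9 * ((i : ℚ) / ((R : ℚ) - 4)) := by ring
  · -- the face misses `≥ R` points: weight zero
    rw [not_le] at hbig
    have h8 : 8 ≤ (G \ clF M B').card := by omega
    unfold hypWeight
    rw [← phiFace_eq_of_clF]
    have hphi0 : phiFace M B' = 0 := by
      have := phiFace_le_of_le hG hd hB'thin h8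
      have h0 : phiM 8 = 0 := by
        unfold phiM phiQ
        norm_num
      rw [h0] at this
      exact le_antisymm this (phiFace_nonneg _)
    rw [hphi0, zero_mul]
    positivity

end PercRepro.Shadow
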